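import Summits.QuantumFields.BalabanUV.T4Continuum.Support.OutputRateInsertion
import Summits.QuantumFields.BalabanUV.T4Continuum.Support.OutputRateOpHolomorphic

/-!
# OutputRateInsertionStructural — wall W2-ins (`InsOpModel.InsOpEnvelope`: analyticity + bound of the history INSERTION along complex
# insertion-operator lines) of binder row NE5 DISCHARGED BY STRUCTURE in two forms: COMPOSITION (the insertion is a table functional,
# holomorphic on a configuration domain, composed with a configuration map holomorphic in the insertion-operator datum and mapping the
# operator ball INTO that domain) and INTEGRAL (the insertion is a dominated holomorphic parametric integral of the operator datum)
# (cell `pub-balaban`, T⁴ fan-out, `HOME/BINDER-OWNERS.md` row NE5, owner lineage t4-ne5-p1, gen 28, route P1 «input-interpolation Cauchy»)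

HONEST FRAMING (T4-DAG PAGE 1).  Rung (B)+1 on ONE finite four-torus of fixed physical size — NOT infinite volume, NOT a mass gap, NOT the
Clay problem; `FlowStep.BetaPertH`, (B), (B^μ) do not occur here.  NE5 (`T4OutputRate.NE5`) is NOT PRINTED and NOT PROVED (spine 0/9,
unchanged).  Nothing of Bałaban's series is asserted; 0 cite tags (the located print: [II] = [Balaban1988RG2Cluster] Lemma 1 p. 9 (1.33)–(1.36)
— the earlier actions re-expressed as `Σ_Y 𝐕′_k(Y, U, J, B)` with `𝐕′_k(Y, ·)` «defined and analytic on the space U^c_{k+1}(Y, (1+β)α₀,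
(1+β)α₁, α₀) × {B : |B| < ε₁g_k^{−1} on Y}» and bounded by (1.36); [I] = [Balaban1987RG1] (1.9)/(1.18) p. 261/263 — the inductive
ANALYTICITY of `𝐄^{(j)}(X, g_{j−1}, 𝐔, 𝐉)` on `𝐔^c_j(X, α₀, α₁)` with the uniform bound `E₀e^{−κd_j(X)}`; [II] p. 15 «with constants α′₀, α′₁
much bigger than α₀, α₁, therefore we can restrict them» — all quoted verbatim in the lineage's loci sheet and the leaf
`T4InputCauchyRateData` §11; here they are cited for KIND only).  HONEST DEPENDENCY (cell, verbatim): continuum YM on T⁴ ⇐ BetaPertH ∧ nine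
spine estimates (0/9 proved); BetaPertH ⇐ (D1) ∧ (D4) ∧ CAP+tail; G-an2-4 gates asym, D1 and NE2/3/4.

WHAT THIS MODULE IS.  `OutputRateInsertion` (gen 25, p202795) PRODUCED W4 from W1-ins ∧ `InsOpEnvelope` ∧ reach, leaving
`InsOpEnvelope W κ E₀ Gi` — «along every complex insertion-operator line `opIB + ζu`, `|ζ| ≤ 1`, `‖u‖ ≤ rI k`, the insertion of a
level-`E₀` table is complex differentiable on the closed unit disc and bounded by `Gi·rHist k`» — as an [analysis] HYPOTHESIS of the
same class as W2-op.  Gen 28 made W2-op structural (`OutputRateOpHolomorphic`); this module does the same for W2-ins: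
* §1 COMPOSITION: shape `InsOpComposition N W κ E₀ Gi cfg Φ 𝒪 D` — per step and background, an OPEN-free bookkeeping of three facts:
  the closed insertion-operator ball of radius `rI k` around `opIB` lies in an operator domain `𝒪` on which the CONFIGURATION MAP
  `cfg k : OpI → Cfg k` is holomorphic and maps into the configuration domain `D`; on `D` the TABLE FUNCTIONAL `Φ k t : Cfg k → Hist` of
  every level-`E₀` table is holomorphic and bounded by `Gi·rHist k` (printed KIND: the inductive analyticity (1.9)/(1.18) of [I] and
  Lemma 1 (1.34)/(1.36) of [II] — the earlier actions ARE analytic functionals of the configuration with a uniform bound; the domain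
  inclusion `cfg(ball) ⊆ D` is the printed SLACK «α′₀, α′₁ much bigger than α₀, α₁» of [II] p. 15, an ARITHMETIC condition on the margin
  `rI`); and the insertion IS the composition, `Ins k o t = Φ k t (cfg k o)` on `𝒪`.  **`insOpEnvelope_of_composition`**: ⟹
  `InsOpEnvelope W κ E₀ Gi` (chain rule along the line + the bound); `insBoundA_of_composition` (run A's one-run bound when `opIA ∈ 𝒪`).
* §2 INTEGRAL: shape `InsOpIntegral N W κ E₀ Gi μ f 𝒪` (the insertion of a level-`E₀` table is `∫ f k t o a dμ` with `f(·, a)`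
  holomorphic on `𝒪 ⊇` the closed operator ball, a.e.-measurable, locally uniformly dominated, ONE majorant of mass `≤ Gi·rHist k` on the
  ball — `Hist`-valued Bochner integral) and **`insOpEnvelope_of_integral`** (the engine
  `Literature.Analysis.Complex.differentiableOn_integral_of_dominated`, valued in the Banach space `Hist`).
STATUS (census).  W2-ins is RELOCATED, not proved for Bałaban's insertion: to (i) holomorphy of the configuration / kernel map in the
insertion-operator datum (algebraic), (ii) the analyticity + bound of the table functional on the configuration domain (printed KIND, a
quoted-leaf TYPE like L05/L06 — NOT asserted here), (iii) the domain inclusion = an arithmetic margin condition on `rI` against the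
printed slack.  W2-ins is CONSTANT-only downstream (enters `δ′` through `Gi`, never the gain or S).  No wall is discharged from print; NE5
NOT PROVED; spine 0/9; rung (B)+1 finite T⁴; NOT infinite volume / mass gap / Clay.  0 sorry; axioms ⊆ {propext, Classical.choice,
Quot.sound}.
-/

noncomputable section

open Set Metric MeasureTheory Filter

namespace Summit.QuantumFields.BalabanUV.T4Continuum.OutputRateInsertionStructural

open Literature.MathematicalPhysics.QuantumFieldTheory.Balaban1983to89
open Literature.MathematicalPhysics.QuantumFieldTheory.Balaban1983to89.T4OutputRate
open Literature.MathematicalPhysics.QuantumFieldTheory.Balaban1983to89.T4InputCauchyRateData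
open Summit.QuantumFields.BalabanUV.T4Continuum.OutputRateInsertion

variable {C : Carriers} {Op Hist : Type*} [NormedAddCommGroup Op] [NormedSpace ℂ Op] [NormedAddCommGroup Hist]
  [NormedSpace ℂ Hist] {M : StepModel C Op Hist} {OpI : Type*} [NormedAddCommGroup OpI] [NormedSpace ℂ OpI]
  (N : InsOpModel M OpI)

/-- An insertion-operator line of length at most the margin stays in the closed operator ball. [folklore] -/
theorem lineMap_mem_closedBall (c : OpI) {r : ℝ} {u : OpI} (hu : ‖u‖ ≤ r) {ζ : ℂ} (hζ : ζ ∈ closedBall (0 : ℂ) 1) :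
    c + ζ • u ∈ closedBall c r := by
  rw [mem_closedBall, dist_zero_right] at hζ
  rw [mem_closedBall, dist_eq_norm, add_sub_cancel_left, norm_smul]
  calc ‖ζ‖ * ‖u‖ ≤ 1 * r := mul_le_mul hζ hu (norm_nonneg _) zero_le_one
    _ = r := one_mul _

/-! ## §1 Composition: table functional (analytic on a configuration domain) ∘ configuration map (holomorphic in the operator datum) -/

section Composition

variable {Cfg : ℕ → Type*} [∀ k, NormedAddCommGroup (Cfg k)] [∀ k, NormedSpace ℂ (Cfg k)]

/-- STRUCTURAL SHAPE `InsOpComposition N W κ E₀ Gi cfg Φ 𝒪 D` ([analysis] dictionary, asserted nowhere): at every step `k` and background,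
(a) `closedBall (opIB g U k) (rI k) ⊆ 𝒪 k g U`, the configuration map `cfg k` is holomorphic on `𝒪 k g U` and maps it into the
configuration domain `D k g U`; (b) for every level-`E₀` table `t`, the table functional `Φ k t` is holomorphic on `D k g U` and bounded there
by `Gi·rHist k`; (c) `Ins k o t = Φ k t (cfg k o)` for `o ∈ 𝒪 k g U`. [folklore] -/
def InsOpComposition (W : Set (ℕ → ℝ)) (κ E₀ Gi : ℝ) (cfg : ∀ k, OpI → Cfg k) (Φ : ∀ k, (C.Dom → ℝ) → Cfg k → Hist)
    (𝒪 : ℕ → (ℕ → ℝ) → C.BgB → Set OpI) (D : ∀ k, (ℕ → ℝ) → C.BgB → Set (Cfg k)) : Prop :=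
  ∀ k, ∀ g ∈ W, ∀ (U : C.BgB),
    closedBall (N.opIB g U k) (N.rI k) ⊆ 𝒪 k g U ∧ DifferentiableOn ℂ (cfg k) (𝒪 k g U) ∧ MapsTo (cfg k) (𝒪 k g U) (D k g U) ∧
    ∀ t : C.Dom → ℝ, (∀ Y, |t Y| ≤ E₀ * Real.exp (-(κ * C.d Y))) →
      DifferentiableOn ℂ (Φ k t) (D k g U) ∧ (∀ c ∈ D k g U, ‖Φ k t c‖ ≤ Gi * M.rHist k) ∧
        ∀ o ∈ 𝒪 k g U, N.Ins k o t = Φ k t (cfg k o)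

variable {N}

/-- **COMPOSITION ⟹ W2-ins**: `InsOpComposition … ⟹ InsOpEnvelope N W κ E₀ Gi` — along the line `opIB + ζu` (inside the closed operator
ball, hence in `𝒪`) the insertion is `Φ k t ∘ cfg k ∘ (affine line)`, complex differentiable by the chain rule, bounded by the table
functional's bound on `D`. [folklore] -/
theorem insOpEnvelope_of_composition {W : Set (ℕ → ℝ)} {κ E₀ Gi : ℝ} {cfg : ∀ k, OpI → Cfg k} {Φ : ∀ k, (C.Dom → ℝ) → Cfg k → Hist}
    {𝒪 : ℕ → (ℕ → ℝ) → C.BgB → Set OpI} {D : ∀ k, (ℕ → ℝ) → C.BgB → Set (Cfg k)}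
    (hcomp : InsOpComposition N W κ E₀ Gi cfg Φ 𝒪 D) : N.InsOpEnvelope W κ E₀ Gi := by
  intro k g hg U t ht u hu
  obtain ⟨hsub, hcfg, hmaps, ht'⟩ := hcomp k g hg U
  obtain ⟨hΦ, hbd, hrepr⟩ := ht' t ht
  have hline : MapsTo (fun ζ : ℂ => N.opIB g U k + ζ • u) (closedBall (0 : ℂ) 1) (𝒪 k g U) := fun ζ hζ =>
    hsub (lineMap_mem_closedBall _ hu hζ)
  have hdiff : DifferentiableOn ℂ (fun ζ : ℂ => Φ k t (cfg k (N.opIB g U k + ζ • u))) (closedBall 0 1) :=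
    hΦ.comp (hcfg.comp (by fun_prop : Differentiable ℂ fun ζ : ℂ => N.opIB g U k + ζ • u).differentiableOn hline) (hmaps.comp hline)
  refine ⟨hdiff.congr fun ζ hζ => hrepr _ (hline hζ), fun ζ hζ => ?_⟩
  rw [hrepr _ (hline hζ)]
  exact hbd _ (hmaps (hline hζ))

/-- Run A's one-run size bound `InsBoundA` from the composition data when run A's insertion-operator datum also lies in `𝒪`. [folklore] -/
theorem insBoundA_of_composition {W : Set (ℕ → ℝ)} {κ E₀ Gi : ℝ} {cfg : ∀ k, OpI → Cfg k} {Φ : ∀ k, (C.Dom → ℝ) → Cfg k → Hist}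
    {𝒪 : ℕ → (ℕ → ℝ) → C.BgB → Set OpI} {D : ∀ k, (ℕ → ℝ) → C.BgB → Set (Cfg k)}
    (hcomp : InsOpComposition N W κ E₀ Gi cfg Φ 𝒪 D) (hA : ∀ k, ∀ g ∈ W, ∀ (U : C.BgB), N.opIA g U k ∈ 𝒪 k g U) :
    N.InsBoundA W κ E₀ Gi := by
  intro k g hg U t ht
  obtain ⟨-, -, hmaps, ht'⟩ := hcomp k g hg U
  obtain ⟨-, hbd, hrepr⟩ := ht' t ht
  rw [hrepr _ (hA k g hg U)]
  exact hbd _ (hmaps (hA k g hg U))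

end Composition

/-! ## §2 Integral: the insertion as a dominated holomorphic parametric integral of the operator datum (Banach-valued) -/

section Integral

/-- STRUCTURAL SHAPE `InsOpIntegral N W κ E₀ Gi μ f 𝒪` ([analysis], asserted nowhere): at every step and background, for every level-`E₀`
table, on an operator domain `𝒪 ⊇ closedBall opIB (rI k)` the insertion IS `∫ f k t o a dμ` (`Hist`-valued Bochner integral) with
`f(·, a)` holomorphic on `𝒪` for a.e. `a`, `f(o, ·)` a.e.-strongly measurable, locally uniformly dominated on `𝒪`, and dominated on the
closed ball by ONE majorant of mass `≤ Gi·rHist k`. [folklore] -/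
def InsOpIntegral (W : Set (ℕ → ℝ)) (κ E₀ Gi : ℝ) {α : ℕ → Type*} [∀ k, MeasurableSpace (α k)]
    (μ : ∀ k, (C.Dom → ℝ) → Measure (α k)) (f : ∀ k, (C.Dom → ℝ) → OpI → α k → Hist) (𝒪 : ℕ → (ℕ → ℝ) → C.BgB → Set OpI) :
    Prop :=
  ∀ k, ∀ g ∈ W, ∀ (U : C.BgB) (t : C.Dom → ℝ), (∀ Y, |t Y| ≤ E₀ * Real.exp (-(κ * C.d Y))) →
    closedBall (N.opIB g U k) (N.rI k) ⊆ 𝒪 k g U ∧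
    (∀ o ∈ 𝒪 k g U, AEStronglyMeasurable (f k t o) (μ k t)) ∧
    (∀ᵐ a ∂(μ k t), DifferentiableOn ℂ (fun o => f k t o a) (𝒪 k g U)) ∧
    (∀ o₀ ∈ 𝒪 k g U, ∃ R : ℝ, 0 < R ∧ ball o₀ R ⊆ 𝒪 k g U ∧ ∃ bound : α k → ℝ, Integrable bound (μ k t) ∧
        ∀ᵐ a ∂(μ k t), ∀ o ∈ ball o₀ R, ‖f k t o a‖ ≤ bound a) ∧
    (∃ bd : α k → ℝ, Integrable bd (μ k t) ∧ (∀ᵐ a ∂(μ k t), ∀ o ∈ closedBall (N.opIB g U k) (N.rI k), ‖f k t o a‖ ≤ bd a) ∧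
        ∫ a, bd a ∂(μ k t) ≤ Gi * M.rHist k) ∧
    (∀ o ∈ 𝒪 k g U, N.Ins k o t = ∫ a, f k t o a ∂(μ k t))

variable {N}

/-- **INTEGRAL ⟹ W2-ins**: `InsOpIntegral … ⟹ InsOpEnvelope N W κ E₀ Gi` — holomorphy of dominated `Hist`-valued parameter integrals
(`Literature.Analysis.Complex.differentiableOn_integral_of_dominated`) along the operator line, and the majorant's mass. [folklore] -/
theorem insOpEnvelope_of_integral {W : Set (ℕ → ℝ)} {κ E₀ Gi : ℝ} {α : ℕ → Type*} [∀ k, MeasurableSpace (α k)]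
    {μ : ∀ k, (C.Dom → ℝ) → Measure (α k)} {f : ∀ k, (C.Dom → ℝ) → OpI → α k → Hist} {𝒪 : ℕ → (ℕ → ℝ) → C.BgB → Set OpI}
    (hint : InsOpIntegral N W κ E₀ Gi μ f 𝒪) : N.InsOpEnvelope W κ E₀ Gi := by
  intro k g hg U t ht u hu
  obtain ⟨hsub, hmeas, hdiff, hdom, ⟨bd, hbdi, hble, hbud⟩, hrepr⟩ := hint k g hg U t ht
  have hline : MapsTo (fun ζ : ℂ => N.opIB g U k + ζ • u) (closedBall (0 : ℂ) 1) (closedBall (N.opIB g U k) (N.rI k)) :=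
    fun ζ hζ => lineMap_mem_closedBall _ hu hζ
  have hS : MapsTo (fun ζ : ℂ => N.opIB g U k + ζ • u) (closedBall (0 : ℂ) 1) (𝒪 k g U) := fun ζ hζ => hsub (hline hζ)
  have hF : DifferentiableOn ℂ (fun ζ : ℂ => ∫ a, f k t (N.opIB g U k + ζ • u) a ∂(μ k t)) (closedBall 0 1) :=
    (Literature.Analysis.Complex.differentiableOn_integral_of_dominated hmeas hdiff hdom).comp
      (by fun_prop : Differentiable ℂ fun ζ : ℂ => N.opIB g U k + ζ • u).differentiableOn hS
  refine ⟨hF.congr fun ζ hζ => hrepr _ (hS hζ), fun ζ hζ => ?_⟩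
  rw [hrepr _ (hS hζ)]
  exact (norm_integral_le_of_norm_le hbdi (by filter_upwards [hble] with a ha using ha _ (hline hζ))).trans hbud

end Integral

end Summit.QuantumFields.BalabanUV.T4Continuum.OutputRateInsertionStructural

end
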